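import Mathlib.Topology.Homotopy.Lifting
import Mathlib.AlgebraicTopology.FundamentalGroupoid.SimplyConnected
import Mathlib.Analysis.Convex.Contractible
import Mathlib.Analysis.Normed.Module.Connected
import Mathlib.Topology.Connected.LocallyPathConnected
import Literature.Geometry.Lorentzian.AsymptoticFlatness
import HarnessLib

/-!
# Coverings of a space with an asymptotically flat end by `ℝ³` are injective

Let `X` be a topological space charted on `E3 = ℝ³` carrying an asymptotically flat end
`e : AFEnd X` (`AsymptoticFlatness.lean`: an open `U ⊆ X` with a diffeomorphism
`U ≅ {x : ℝ³ | R < ‖x‖}`, closed at infinity — no decay of any metric is involved), and let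
`F : E3 → X` be a covering map onto `X`. Then `F` is injective (`AFEnd.injective_of_isCoveringMap`),
hence a homeomorphism (`AFEnd.isHomeomorph_of_isCoveringMap`). In other words such an `X` is
simply connected; this is the topological half of step 4 of the Schoen–Yau rigidity DAG
(`PositiveMassRigidity.lean`, fact `euclidean_of_isFlat_of_isSoleEnd`: Greene–Wu, Proc. Sympos.
Pure Math. 54.3 (1993), Thm. A — *a complete manifold which is simply connected at infinity, has
nonnegative curvature and is flat outside a compact set is isometric to `ℝⁿ`* — whose flat case
reduces, by the Cartan–Hadamard/Killing–Hopf theorem (Lee, *Introduction to Riemannian Manifolds*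
(2018), Thm. 12.8: `exp_p : T_pM → M` is a covering map), to the present statement). The
compactness of the complement of the end (`AFEnd.IsSoleEnd`) is not needed.

## Proof

Suppose `F v₁ = F v₂` with `v₁ ≠ v₂`. Since `E3` is simply connected, `F` lifts through itself
to a deck transformation `τ` with `τ v₁ = v₂` (Mathlib's lifting criterion
`IsCoveringMap.existsUnique_continuousMap_lifts`), which is fixed-point free by uniqueness of
lifts (`exists_deck_of_isCoveringMap`). The closed far region `A = Φ⁻¹{R + 1 ≤ ‖x‖}` of the end
is homeomorphic to `{z : ℝ³ | 1 ≤ ‖z‖}` and its interior is simply connected, so the embedding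
`A ↪ X` lifts to `J : A → E3` (we lift on the punctured space `ℝ³ ∖ {0} ≅ {R < ‖x‖}`, covering
it by the two star-shaped open sets "complement of a closed half-line", on each of which the
lifting criterion applies, and matching the two lifts on the connected overlap, the complement
of a line, `isPathConnected_compl_of_one_lt_codim`). The lift `J` is an injective map with
`J(int A)` open (`F` is a local homeomorphism) and `J(A)` closed and non-compact, hence
unbounded; as the frontier of `J(int A)` lies in the compact set `J(∂A)`, the connected
complement of a large ball lies inside `J(int A)`. The same holds for the second lift `τ ∘ J`;
but `J(int A)` and `τ(J(int A))` are disjoint because `τ` has no fixed point and `A ↪ X` is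
injective — a contradiction, two disjoint sets cannot both contain a neighbourhood of infinity.

## Main results

* `closedRay`, `starConvex_compl_closedRay`: the complement of a closed half-line is star-shaped;
* `exists_lift_on_compl_zero`: maps on `ℝ³ ∖ {0}` lift through covering maps;
* `exists_deck_of_isCoveringMap`: a non-injective covering by a simply connected space has a
  fixed-point free deck transformation;
* `AFEnd.injective_of_isCoveringMap`, `AFEnd.isHomeomorph_of_isCoveringMap`.

## References

* R. E. Greene, H. Wu, *Nonnegatively curved manifolds which are flat outside a compact set*,
  Proc. Sympos. Pure Math. 54, Part 3 (1993) 327–335, Thm. A. [GreeneWu1993]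
* J. M. Lee, *Introduction to Riemannian Manifolds*, 2nd ed., GTM 176, Springer 2018, Thm. 12.8
  (Cartan–Hadamard), Cor. A.59, Prop. A.54 (lifting properties of covering maps). [Lee2018]
* A. Hatcher, *Algebraic Topology*, CUP 2002, Prop. 1.33–1.34 (lifting criterion, uniqueness of
  lifts), as formalised in Mathlib's `Topology/Homotopy/Lifting.lean`.
-/

noncomputable section

open Set Metric Function Filter Topology

namespace Literature.Geometry.Lorentzian

/-! ### Closed half-lines and their star-shaped complements -/

section Ray

variable {E : Type*} [NormedAddCommGroup E] [NormedSpace ℝ E]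

/-- The closed half-line `{s • v | 0 ≤ s}` spanned by `v`. [folklore] -/
def closedRay (v : E) : Set E := (fun s : ℝ ↦ s • v) '' Ici 0

/-- Membership in a closed half-line. [folklore] -/
theorem mem_closedRay {v z : E} : z ∈ closedRay v ↔ ∃ s : ℝ, 0 ≤ s ∧ s • v = z := by
  simp [closedRay]

/-- The origin lies on every closed half-line. [folklore] -/
theorem zero_mem_closedRay (v : E) : (0 : E) ∈ closedRay v :=
  mem_closedRay.2 ⟨0, le_rfl, zero_smul _ _⟩

/-- A closed half-line is closed (`s ↦ s • v` is a closed embedding for `v ≠ 0`). [folklore] -/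
theorem isClosed_closedRay [FiniteDimensional ℝ E] {v : E} (hv : v ≠ 0) : IsClosed (closedRay v) :=
  (isClosedEmbedding_smul_left hv).isClosedMap _ isClosed_Ici

/-- `-v` does not lie on the closed half-line of `v ≠ 0`. [folklore] -/
theorem neg_not_mem_closedRay {v : E} (hv : v ≠ 0) : -v ∉ closedRay v := by
  intro hmem
  obtain ⟨s, hs, hsv⟩ := mem_closedRay.1 hmem
  have h : (s + 1) • v = 0 := by rw [add_smul, one_smul, hsv, neg_add_cancel]
  rcases smul_eq_zero.1 h with h | h
  · linarith
  · exact hv h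

/-- **The complement of a closed half-line is star-shaped** about the opposite point `-v`.
[folklore] -/
theorem starConvex_compl_closedRay {v : E} (hv : v ≠ 0) : StarConvex ℝ (-v) (closedRay v)ᶜ := by
  intro q hq a b ha hb hab hmem
  obtain ⟨s, hs, hsq⟩ := mem_closedRay.1 hmem
  -- `b • q = (s + a) • v`
  have hbq : b • q = (s + a) • v := by
    rw [add_smul, hsq, smul_neg]; abel
  rcases hb.eq_or_lt with rfl | hb'
  · rw [add_zero] at hab
    subst hab
    rw [zero_smul] at hbq
    rcases smul_eq_zero.1 hbq.symm with h | h
    · linarith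
    · exact hv h
  · apply hq
    refine mem_closedRay.2 ⟨(s + a) / b, by positivity, ?_⟩
    rw [div_eq_inv_mul, mul_smul, ← hbq, smul_smul, inv_mul_cancel₀ hb'.ne', one_smul]

/-- The complements of the two opposite closed half-lines cover the punctured space. [folklore] -/
theorem compl_closedRay_union_compl_closedRay_neg {v : E} (hv : v ≠ 0) :
    (closedRay v)ᶜ ∪ (closedRay (-v))ᶜ = {0}ᶜ := by
  ext z
  simp only [mem_union, mem_compl_iff, mem_singleton_iff]
  constructor
  · rintro h rfl
    rcases h with h | h <;> exact h (zero_mem_closedRay _)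
  · intro hz
    by_contra h
    push Not at h
    obtain ⟨⟨s, hs, hsz⟩, ⟨t, ht, htz⟩⟩ := mem_closedRay.1 h.1, mem_closedRay.1 h.2
    have hst : (s + t) • v = 0 := by
      rw [add_smul, hsz, ← htz, smul_neg, neg_add_cancel]
    rcases smul_eq_zero.1 hst with h' | h'
    · have hs0 : s = 0 := by linarith
      rw [hs0, zero_smul] at hsz
      exact hz hsz.symm
    · exact hv h'

/-- The two opposite closed half-lines make up the line `ℝ ∙ v`. [folklore] -/
theorem compl_closedRay_inter_compl_closedRay_neg (v : E) :
    (closedRay v)ᶜ ∩ (closedRay (-v))ᶜ = ((ℝ ∙ v : Submodule ℝ E) : Set E)ᶜ := by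
  rw [← compl_union]
  congr 1
  ext z
  simp only [mem_union, SetLike.mem_coe, Submodule.mem_span_singleton, mem_closedRay]
  constructor
  · rintro (⟨s, -, rfl⟩ | ⟨s, -, rfl⟩)
    · exact ⟨s, rfl⟩
    · exact ⟨-s, by rw [smul_neg, neg_smul]⟩
  · rintro ⟨a, rfl⟩
    rcases le_total 0 a with ha | ha
    · exact Or.inl ⟨a, ha, rfl⟩
    · exact Or.inr ⟨-a, by linarith, by rw [smul_neg, neg_smul, neg_neg]⟩

/-- In dimension at least `3` the complement of a line is path connected (Mathlib's
`isPathConnected_compl_of_one_lt_codim`). [folklore] -/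
theorem isPathConnected_compl_span_singleton [FiniteDimensional ℝ E]
    (h3 : 3 ≤ Module.finrank ℝ E) {v : E} (hv : v ≠ 0) :
    IsPathConnected (((ℝ ∙ v : Submodule ℝ E) : Set E)ᶜ) := by
  refine isPathConnected_compl_of_one_lt_codim ?_
  have hq := (ℝ ∙ v).finrank_quotient_add_finrank
  rw [finrank_span_singleton hv] at hq
  have h2 : 2 ≤ Module.finrank ℝ (E ⧸ (ℝ ∙ v)) := by omega
  rw [← Module.finrank_eq_rank]
  exact_mod_cast h2

end Ray

/-! ### Lifting maps on the punctured space through a covering map -/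

section Lift

variable {E : Type*} [NormedAddCommGroup E] [NormedSpace ℝ E] [FiniteDimensional ℝ E]
  {W : Type*} [TopologicalSpace W] {X : Type*} [TopologicalSpace X]

/-- **Lifting on the complement of a closed half-line.** A map `f` continuous on the open
star-shaped set `(closedRay v)ᶜ` lifts through a covering map `p : W → X`, with prescribed value
`w₀` over a prescribed base point `z₀` (the lifting criterion for the simply connected, locally
path connected space `(closedRay v)ᶜ`; Hatcher, Prop. 1.33, Mathlib's
`IsCoveringMap.existsUnique_continuousMap_lifts`). [folklore] -/
theorem exists_lift_on_compl_closedRay {p : W → X} (hp : IsCoveringMap p) {v : E} (hv : v ≠ 0)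
    {f : E → X} (hf : ContinuousOn f (closedRay v)ᶜ) {z₀ : E} (hz₀ : z₀ ∈ (closedRay v)ᶜ)
    {w₀ : W} (hw₀ : p w₀ = f z₀) :
    ∃ g : E → W, ContinuousOn g (closedRay v)ᶜ ∧ (∀ z ∈ (closedRay v)ᶜ, p (g z) = f z) ∧
      g z₀ = w₀ := by
  set T : Set E := (closedRay v)ᶜ with hT_def
  have hTo : IsOpen T := (isClosed_closedRay hv).isOpen_compl
  haveI : LocallyPathConnectedSpace T := hTo.locallyPathConnectedSpace
  haveI : ContractibleSpace T :=
    (starConvex_compl_closedRay hv).contractibleSpace ⟨-v, neg_not_mem_closedRay hv⟩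
  let fT : C(T, X) := ⟨T.restrict f, hf.restrict⟩
  obtain ⟨G, ⟨hG0, hGp⟩, -⟩ := hp.existsUnique_continuousMap_lifts fT ⟨z₀, hz₀⟩ w₀ (by simpa [fT] using hw₀)
  classical
  refine ⟨fun z ↦ if hz : z ∈ T then G ⟨z, hz⟩ else w₀, ?_, ?_, ?_⟩
  · rw [continuousOn_iff_continuous_restrict]
    have h : T.restrict (fun z ↦ if hz : z ∈ T then G ⟨z, hz⟩ else w₀) = G := by
      ext ⟨z, hz⟩
      simp [hz]
    rw [h]
    exact G.continuous
  · intro z hz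
    have h := congr_fun hGp ⟨z, hz⟩
    simp only [comp_apply] at h
    simp only [hz, dite_true]
    exact h
  · simp only [hz₀, dite_true]
    exact hG0

/-- **Lifting on the punctured space.** In dimension at least `3`, a map `f` continuous on
`{0}ᶜ` lifts through a covering map `p : W → X` on `{0}ᶜ`, with prescribed value over a base
point `z₀` off a line `ℝ ∙ v`: cover `{0}ᶜ` by the complements of the opposite closed half-lines
`±v`, lift on each (`exists_lift_on_compl_closedRay`) with the same value at `z₀`, and match the
two lifts on the overlap, the connected complement of the line (uniqueness of lifts, Hatcher
Prop. 1.34, `IsCoveringMap.eqOn_of_comp_eqOn`). [folklore] -/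
theorem exists_lift_on_compl_zero (h3 : 3 ≤ Module.finrank ℝ E) {p : W → X} (hp : IsCoveringMap p)
    {f : E → X} (hf : ContinuousOn f {0}ᶜ) {v z₀ : E} (hv : v ≠ 0)
    (hz₀ : z₀ ∉ (ℝ ∙ v : Submodule ℝ E)) {w₀ : W} (hw₀ : p w₀ = f z₀) :
    ∃ g : E → W, ContinuousOn g {0}ᶜ ∧ (∀ z, z ≠ 0 → p (g z) = f z) ∧ g z₀ = w₀ := by
  have hv' : -v ≠ 0 := neg_ne_zero.2 hv
  have hcover := compl_closedRay_union_compl_closedRay_neg hv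
  have hinter := compl_closedRay_inter_compl_closedRay_neg v
  have hz₀' : z₀ ∈ (closedRay v)ᶜ ∩ (closedRay (-v))ᶜ := by
    rw [hinter]; exact hz₀
  have hsub₁ : (closedRay v)ᶜ ⊆ ({0}ᶜ : Set E) := hcover ▸ subset_union_left
  have hsub₂ : (closedRay (-v))ᶜ ⊆ ({0}ᶜ : Set E) := hcover ▸ subset_union_right
  obtain ⟨g₁, hg₁c, hg₁p, hg₁0⟩ :=
    exists_lift_on_compl_closedRay hp hv (hf.mono hsub₁) hz₀'.1 hw₀
  obtain ⟨g₂, hg₂c, hg₂p, hg₂0⟩ :=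
    exists_lift_on_compl_closedRay hp hv' (hf.mono hsub₂) hz₀'.2 hw₀
  -- the two lifts agree on the overlap
  have hagree : EqOn g₁ g₂ ((closedRay v)ᶜ ∩ (closedRay (-v))ᶜ) := by
    refine hp.eqOn_of_comp_eqOn ?_ (hg₁c.mono inter_subset_left) (hg₂c.mono inter_subset_right)
      (fun z hz ↦ ?_) hz₀' (hg₁0.trans hg₂0.symm)
    · rw [hinter]
      exact (isPathConnected_compl_span_singleton h3 hv).isConnected.isPreconnected
    · simp only [comp_apply, hg₁p z hz.1, hg₂p z hz.2]
  classical
  refine ⟨fun z ↦ if z ∈ (closedRay v)ᶜ then g₁ z else g₂ z, ?_, ?_, ?_⟩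
  · -- continuity: the glued map is `g₁` on `(closedRay v)ᶜ` and `g₂` on `(closedRay (-v))ᶜ`
    have h₂ : EqOn (fun z ↦ if z ∈ (closedRay v)ᶜ then g₁ z else g₂ z) g₂ (closedRay (-v))ᶜ := by
      intro z hz
      by_cases h : z ∈ (closedRay v)ᶜ
      · simp only [h, ite_true]; exact hagree ⟨h, hz⟩
      · simp only [h, ite_false]
    have h₁ : EqOn (fun z ↦ if z ∈ (closedRay v)ᶜ then g₁ z else g₂ z) g₁ (closedRay v)ᶜ := by
      intro z hz
      simp only [hz, ite_true]
    intro z hz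
    rw [← hcover] at hz
    rcases hz with hz | hz
    · exact ((hg₁c.congr h₁).continuousAt ((isClosed_closedRay hv).isOpen_compl.mem_nhds hz)).continuousWithinAt
    · exact ((hg₂c.congr h₂).continuousAt ((isClosed_closedRay hv').isOpen_compl.mem_nhds hz)).continuousWithinAt
  · intro z hz
    have hz' : z ∈ (closedRay v)ᶜ ∪ (closedRay (-v))ᶜ := by rw [hcover]; exact hz
    by_cases h : z ∈ (closedRay v)ᶜ
    · simp only [h, ite_true]; exact hg₁p z h
    · simp only [h, ite_false]
      exact hg₂p z (hz'.resolve_left h)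
  · simp only [hz₀'.1, ite_true]; exact hg₁0

end Lift

/-! ### Deck transformations of a non-injective covering by a simply connected space -/

section Deck

variable {W : Type*} [TopologicalSpace W] [SimplyConnectedSpace W] [LocallyPathConnectedSpace W]
  {X : Type*} [TopologicalSpace X]

/-- **A non-injective covering by a simply connected space has a fixed-point free deck
transformation**: if `p : W → X` is a covering map with `W` simply connected and locally path
connected and `p v₁ = p v₂`, `v₁ ≠ v₂`, then there is a continuous `τ : W → W` with `p ∘ τ = p`,
`τ v₁ = v₂` and `τ w ≠ w` for all `w` (lift `p` through itself, Hatcher Prop. 1.33; a deck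
transformation with a fixed point is the identity, Prop. 1.34). [folklore] -/
theorem exists_deck_of_isCoveringMap {p : W → X} (hp : IsCoveringMap p) {v₁ v₂ : W}
    (hne : v₁ ≠ v₂) (heq : p v₁ = p v₂) :
    ∃ τ : W → W, Continuous τ ∧ (∀ w, p (τ w) = p w) ∧ τ v₁ = v₂ ∧ ∀ w, τ w ≠ w := by
  obtain ⟨τ, ⟨hτ0, hτp⟩, -⟩ :=
    hp.existsUnique_continuousMap_lifts ⟨p, hp.continuous⟩ v₁ v₂ heq.symm
  refine ⟨τ, τ.continuous, fun w ↦ congr_fun hτp w, hτ0, fun w hw ↦ hne ?_⟩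
  have hid : (τ : W → W) = id :=
    hp.eq_of_comp_eq τ.continuous continuous_id (by rw [hτp]; rfl) w hw
  rw [← hτ0, hid, id_eq]

end Deck

/-! ### Radial shifts: the punctured space and the exterior of a ball -/

section Radial

/-- The outward radial shift by `R`: `z ↦ (1 + R/‖z‖) z`, a homeomorphism of the punctured space
onto `{R < ‖y‖}` (for `R ≥ 0`) with inverse `radialIn R`. [folklore] -/
def radialOut (R : ℝ) (z : E3) : E3 := (1 + R / ‖z‖) • z

/-- The inward radial shift by `R`: `y ↦ (1 - R/‖y‖) y`. [folklore] -/
def radialIn (R : ℝ) (y : E3) : E3 := (1 - R / ‖y‖) • y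

/-- The outward radial shift increases the norm by `R`. [folklore] -/
theorem norm_radialOut {R : ℝ} (hR : 0 ≤ R) {z : E3} (hz : z ≠ 0) : ‖radialOut R z‖ = ‖z‖ + R := by
  have hn : 0 < ‖z‖ := norm_pos_iff.2 hz
  rw [radialOut, norm_smul, Real.norm_eq_abs, abs_of_nonneg (by positivity)]
  field_simp

/-- The inward radial shift decreases the norm by `R`. [folklore] -/
theorem norm_radialIn {R : ℝ} {y : E3} (hy : R ≤ ‖y‖) (hy0 : y ≠ 0) : ‖radialIn R y‖ = ‖y‖ - R := by
  have hn : 0 < ‖y‖ := norm_pos_iff.2 hy0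
  have h1 : 0 ≤ 1 - R / ‖y‖ := by
    rw [sub_nonneg, div_le_one hn]; exact hy
  rw [radialIn, norm_smul, Real.norm_eq_abs, abs_of_nonneg h1]
  field_simp

/-- The outward radial shift does not hit the origin. [folklore] -/
theorem radialOut_ne_zero {R : ℝ} (hR : 0 ≤ R) {z : E3} (hz : z ≠ 0) : radialOut R z ≠ 0 := by
  rw [← norm_pos_iff, norm_radialOut hR hz]
  have := norm_pos_iff.2 hz
  positivity

/-- The outward radial shift lands outside the ball of radius `R`. [folklore] -/
theorem lt_norm_radialOut {R : ℝ} (hR : 0 ≤ R) {z : E3} (hz : z ≠ 0) : R < ‖radialOut R z‖ := by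
  rw [norm_radialOut hR hz]
  linarith [norm_pos_iff.2 hz]

/-- The inward radial shift of a point outside the ball of radius `R` is not the origin.
[folklore] -/
theorem radialIn_ne_zero {R : ℝ} (hR : 0 ≤ R) {y : E3} (hy : R < ‖y‖) : radialIn R y ≠ 0 := by
  have hy0 : y ≠ 0 := by
    rintro rfl; rw [norm_zero] at hy; linarith
  rw [← norm_pos_iff, norm_radialIn hy.le hy0]
  linarith

/-- `radialIn R` is a left inverse of `radialOut R` off the origin. [folklore] -/
theorem radialIn_radialOut {R : ℝ} (hR : 0 ≤ R) {z : E3} (hz : z ≠ 0) :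
    radialIn R (radialOut R z) = z := by
  have hn : 0 < ‖z‖ := norm_pos_iff.2 hz
  rw [radialIn, norm_radialOut hR hz, radialOut, smul_smul]
  have h : (1 - R / (‖z‖ + R)) * (1 + R / ‖z‖) = 1 := by
    field_simp
    ring
  rw [h, one_smul]

/-- `radialOut R` is a left inverse of `radialIn R` outside the ball of radius `R`. [folklore] -/
theorem radialOut_radialIn {R : ℝ} (hR : 0 ≤ R) {y : E3} (hy : R < ‖y‖) :
    radialOut R (radialIn R y) = y := by
  have hy0 : y ≠ 0 := by
    rintro rfl; rw [norm_zero] at hy; linarith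
  have hn : 0 < ‖y‖ := norm_pos_iff.2 hy0
  have hsub : 0 < ‖y‖ - R := by linarith
  rw [radialOut, norm_radialIn hy.le hy0, radialIn, smul_smul]
  have h : (1 + R / (‖y‖ - R)) * (1 - R / ‖y‖) = 1 := by
    field_simp
    ring
  rw [h, one_smul]

/-- The outward radial shift is continuous off the origin. [folklore] -/
theorem continuousOn_radialOut (R : ℝ) : ContinuousOn (radialOut R) {0}ᶜ := by
  intro z hz
  have hz' : ‖z‖ ≠ 0 := norm_ne_zero_iff.2 hz
  exact ((continuousAt_const.add (continuousAt_const.div continuousAt_id.norm hz')).smul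
    continuousAt_id).continuousWithinAt

/-- The inward radial shift is continuous off the origin. [folklore] -/
theorem continuousOn_radialIn (R : ℝ) : ContinuousOn (radialIn R) {0}ᶜ := by
  intro y hy
  have hy' : ‖y‖ ≠ 0 := norm_ne_zero_iff.2 hy
  exact ((continuousAt_const.sub (continuousAt_const.div continuousAt_id.norm hy')).smul
    continuousAt_id).continuousWithinAt

/-- The exterior of the closed ball of radius `R ≥ 0` is the image of the punctured space under
the outward radial shift. [folklore] -/
theorem radialOut_image_compl_zero {R : ℝ} (hR : 0 ≤ R) :
    radialOut R '' {0}ᶜ = (closedBall (0 : E3) R)ᶜ := by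
  ext y
  simp only [mem_image, mem_compl_iff, mem_singleton_iff, mem_closedBall, dist_zero_right, not_le]
  constructor
  · rintro ⟨z, hz, rfl⟩
    exact lt_norm_radialOut hR hz
  · intro hy
    exact ⟨radialIn R y, radialIn_ne_zero hR hy, radialOut_radialIn hR hy⟩

/-- **The exterior of a closed ball in `ℝ³` is path connected** (it is the image of the
path connected punctured space, Mathlib's `isPathConnected_compl_singleton_of_one_lt_rank`,
under the outward radial shift). [folklore] -/
theorem isPathConnected_compl_closedBall {R : ℝ} (hR : 0 ≤ R) :
    IsPathConnected (closedBall (0 : E3) R)ᶜ := by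
  rw [← radialOut_image_compl_zero hR]
  refine IsPathConnected.image' ?_ (continuousOn_radialOut R)
  refine isPathConnected_compl_singleton_of_one_lt_rank ?_ 0
  rw [← Module.finrank_eq_rank, finrank_euclideanSpace_fin]
  norm_num

end Radial

/-! ### The end read on the punctured space -/

namespace AFEnd

variable {X : Type*} [TopologicalSpace X] [ChartedSpace E3 X] (e : AFEnd X)

/-- A point of the exterior region of the end (the junk value of `puncturedEnd` at `0`). [folklore] -/
def farPoint : exteriorRegion e.R :=
  ⟨EuclideanSpace.single 0 (2 * e.R), by
    rw [mem_exteriorRegion, PiLp.norm_single, Real.norm_eq_abs, abs_of_pos (by linarith [e.R_pos])]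
    linarith [e.R_pos]⟩

/-- **The end read on the punctured space**: `z ↦ Φ((1 + R/‖z‖) z)`, the composite of the
outward radial shift `ℝ³ ∖ {0} → {R < ‖y‖}` with the inverse chart `Φ = dataChart e` of the end
(junk at `z = 0`). It is a homeomorphism of `ℝ³ ∖ {0}` onto the end `U`, under which the closed
far regions `Φ({R + ρ ≤ ‖y‖})` correspond to the exteriors `{ρ ≤ ‖z‖}`. [folklore] -/
def puncturedEnd (z : E3) : X :=
  if hz : e.R < ‖radialOut e.R z‖ then e.dataChart ⟨radialOut e.R z, hz⟩ else e.dataChart e.farPoint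

/-- Off the origin the end read on the punctured space is the inverse chart of the radially
shifted point. [folklore] -/
theorem puncturedEnd_of_ne {z : E3} (hz : z ≠ 0) :
    e.puncturedEnd z = e.dataChart ⟨radialOut e.R z, lt_norm_radialOut e.R_pos.le hz⟩ := by
  rw [puncturedEnd, dif_pos]

/-- The inverse chart of the end is injective. [folklore] -/
theorem dataChart_injective : Injective e.dataChart :=
  Subtype.val_injective.comp e.chart.symm.injective

/-- The inverse chart maps into the end `U`. [folklore] -/
theorem dataChart_mem (y : exteriorRegion e.R) : e.dataChart y ∈ (e.U : Set X) :=
  (e.chart.symm y).2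

/-- The end read on the punctured space is continuous off the origin. [folklore] -/
theorem continuousOn_puncturedEnd : ContinuousOn e.puncturedEnd {0}ᶜ := by
  rw [continuousOn_iff_continuous_restrict]
  have hR := e.R_pos.le
  have h : ({0}ᶜ : Set E3).restrict e.puncturedEnd =
      e.dataChart ∘ fun z : ({0}ᶜ : Set E3) ↦ ⟨radialOut e.R z, lt_norm_radialOut hR z.2⟩ := by
    ext ⟨z, hz⟩
    exact e.puncturedEnd_of_ne hz
  rw [h]
  refine e.contMDiff_dataChart.continuous.comp (Continuous.subtype_mk ?_ _)
  exact (continuousOn_radialOut e.R).restrict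

/-- The end read on the punctured space is injective off the origin. [folklore] -/
theorem injOn_puncturedEnd : InjOn e.puncturedEnd {0}ᶜ := by
  intro z₁ h₁ z₂ h₂ h
  rw [e.puncturedEnd_of_ne h₁, e.puncturedEnd_of_ne h₂] at h
  have h' := congrArg Subtype.val (e.dataChart_injective h)
  simp only at h'
  rw [← radialIn_radialOut e.R_pos.le h₁, ← radialIn_radialOut e.R_pos.le h₂]
  exact congrArg (radialIn e.R) h'

/-- The end read on the punctured space lands in the end `U`. [folklore] -/
theorem puncturedEnd_mem (z : E3) : e.puncturedEnd z ∈ (e.U : Set X) := by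
  unfold puncturedEnd
  split_ifs <;> exact e.dataChart_mem _

/-- **The end read on the punctured space is an open map** (off the origin): the image of an open
`s ⊆ ℝ³ ∖ {0}` is the image under the open embedding `U ↪ X` of the image under the
homeomorphism `chart⁻¹` of an open subset of the exterior region. [folklore] -/
theorem isOpen_image_puncturedEnd {s : Set E3} (hs : IsOpen s) (hs0 : s ⊆ {0}ᶜ) :
    IsOpen (e.puncturedEnd '' s) := by
  have hR := e.R_pos.le
  -- the corresponding open subset of the exterior region
  set V : Set (exteriorRegion e.R) := {y | radialIn e.R (y : E3) ∈ s} with hV_def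
  have hVo : IsOpen V := by
    have hc : Continuous fun y : exteriorRegion e.R ↦ radialIn e.R (y : E3) :=
      (continuousOn_radialIn e.R).comp_continuous continuous_subtype_val fun y ↦ by
        have hy : e.R < ‖(y : E3)‖ := y.2
        intro (h0 : (y : E3) = 0)
        rw [h0, norm_zero] at hy
        exact absurd hy (not_lt.2 hR)
    exact hs.preimage hc
  have heq : e.puncturedEnd '' s = ((↑) : e.U → X) '' (e.chart.symm '' V) := by
    ext x
    simp only [mem_image]
    constructor
    · rintro ⟨z, hz, rfl⟩
      refine ⟨e.chart.symm ⟨radialOut e.R z, lt_norm_radialOut hR (hs0 hz)⟩, ⟨_, ?_, rfl⟩, ?_⟩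
      · show radialIn e.R (radialOut e.R z) ∈ s
        rwa [radialIn_radialOut hR (hs0 hz)]
      · rw [e.puncturedEnd_of_ne (hs0 hz)]; rfl
    · rintro ⟨q, ⟨y, hy, rfl⟩, rfl⟩
      refine ⟨radialIn e.R y, hy, ?_⟩
      rw [e.puncturedEnd_of_ne (radialIn_ne_zero hR y.2)]
      have hyy : (⟨radialOut e.R (radialIn e.R (y : E3)), lt_norm_radialOut hR (radialIn_ne_zero hR y.2)⟩ :
          exteriorRegion e.R) = y := Subtype.ext (radialOut_radialIn hR y.2)
      rw [hyy]; rfl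
  rw [heq]
  exact e.U.isOpen.isOpenMap_subtype_val _ (e.chart.symm.toHomeomorph.isOpenMap _ hVo)

/-- **Closed far regions of the end**: for `ρ > 0` the image of `{ρ ≤ ‖z‖}` under the end read on
the punctured space is the closed far region `Φ({R + ρ ≤ ‖y‖})`, which is closed in `X` (the end
is closed at infinity, `AFEnd.isClosed_far`). [folklore] -/
theorem image_puncturedEnd_eq {ρ : ℝ} (hρ : 0 < ρ) :
    e.puncturedEnd '' {z | ρ ≤ ‖z‖} =
      ((↑) : e.U → X) '' (e.chart ⁻¹' {y | e.R + ρ ≤ ‖(y : E3)‖}) := by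
  have hR := e.R_pos.le
  ext x
  simp only [mem_image, mem_setOf_eq, mem_preimage]
  constructor
  · rintro ⟨z, hz, rfl⟩
    have hz0 : z ≠ 0 := by
      rintro rfl; rw [norm_zero] at hz; linarith
    refine ⟨e.chart.symm ⟨radialOut e.R z, lt_norm_radialOut hR hz0⟩, ?_, ?_⟩
    · rw [Diffeomorph.apply_symm_apply]
      show e.R + ρ ≤ ‖radialOut e.R z‖
      rw [norm_radialOut hR hz0]; linarith
    · rw [e.puncturedEnd_of_ne hz0]; rfl
  · rintro ⟨q, hq, rfl⟩
    have hq' : e.R < ‖(e.chart q : E3)‖ := (e.chart q).2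
    have hq0 : (e.chart q : E3) ≠ 0 := by
      intro h0; rw [h0, norm_zero] at hq'; linarith
    refine ⟨radialIn e.R (e.chart q), ?_, ?_⟩
    · rw [norm_radialIn hq'.le hq0]; linarith
    · rw [e.puncturedEnd_of_ne (radialIn_ne_zero hR hq')]
      have hyy : (⟨radialOut e.R (radialIn e.R (e.chart q : E3)),
          lt_norm_radialOut hR (radialIn_ne_zero hR hq')⟩ : exteriorRegion e.R) = e.chart q :=
        Subtype.ext (radialOut_radialIn hR hq')
      rw [hyy]
      show ((e.chart.symm (e.chart q) : e.U) : X) = q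
      rw [Diffeomorph.symm_apply_apply]

/-- The closed far regions, read on the punctured space, are closed in `X`. [folklore] -/
theorem isClosed_image_puncturedEnd {ρ : ℝ} (hρ : 0 < ρ) :
    IsClosed (e.puncturedEnd '' {z | ρ ≤ ‖z‖}) := by
  rw [e.image_puncturedEnd_eq hρ]
  exact e.isClosed_far (e.R + ρ) (by linarith)

open scoped Classical in
/-- **The inverse of the end read on the punctured space**: `x ↦ (1 - R/‖chart x‖) chart x` on the
end `U` (junk `0` elsewhere), continuous on `U`, a left inverse of `puncturedEnd` off the origin.
[folklore] -/
def puncturedEndInv (x : X) : E3 :=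
  if hx : x ∈ (e.U : Set X) then radialIn e.R (e.chart ⟨x, hx⟩ : E3) else 0

/-- `puncturedEndInv` is a left inverse of `puncturedEnd` off the origin. [folklore] -/
theorem puncturedEndInv_puncturedEnd {z : E3} (hz : z ≠ 0) :
    e.puncturedEndInv (e.puncturedEnd z) = z := by
  have hR := e.R_pos.le
  rw [puncturedEndInv, dif_pos (e.puncturedEnd_mem z)]
  have h : (⟨e.puncturedEnd z, e.puncturedEnd_mem z⟩ : e.U) =
      e.chart.symm ⟨radialOut e.R z, lt_norm_radialOut hR hz⟩ := by
    apply Subtype.ext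
    show e.puncturedEnd z = _
    rw [e.puncturedEnd_of_ne hz]; rfl
  rw [h, Diffeomorph.apply_symm_apply]
  exact radialIn_radialOut hR hz

/-- The inverse of the end read on the punctured space is continuous on the end. [folklore] -/
theorem continuousOn_puncturedEndInv : ContinuousOn e.puncturedEndInv (e.U : Set X) := by
  rw [continuousOn_iff_continuous_restrict]
  have hmk : Continuous fun q : (e.U : Set X) ↦ (⟨(q : X), q.2⟩ : e.U) :=
    continuous_subtype_val.subtype_mk _
  have hc : Continuous fun q : (e.U : Set X) ↦ (e.chart ⟨(q : X), q.2⟩ : E3) :=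
    continuous_subtype_val.comp (e.chart.continuous.comp hmk)
  have h : (e.U : Set X).restrict e.puncturedEndInv =
      fun q : (e.U : Set X) ↦ radialIn e.R (e.chart ⟨(q : X), q.2⟩ : E3) := by
    funext q
    simp only [restrict_apply, puncturedEndInv, dif_pos q.2]
  rw [h]
  refine (continuousOn_radialIn e.R).comp_continuous hc fun q ↦ ?_
  have hq : e.R < ‖(e.chart ⟨(q : X), q.2⟩ : E3)‖ := (e.chart ⟨(q : X), q.2⟩).2
  intro (h0 : (e.chart ⟨(q : X), q.2⟩ : E3) = 0)
  rw [h0, norm_zero] at hq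
  exact absurd hq (not_lt.2 e.R_pos.le)

end AFEnd

/-! ### Lifts of the end through a covering by `ℝ³` -/

namespace AFEnd

variable {X : Type*} [TopologicalSpace X] [ChartedSpace E3 X] (e : AFEnd X)
  {F : E3 → X} {J : E3 → E3}

/-- A lift of the end (read on the punctured space) through `F` is injective off the origin.
[folklore] -/
theorem injOn_lift (hJ : ∀ z, z ≠ 0 → F (J z) = e.puncturedEnd z) : InjOn J {0}ᶜ := by
  intro z₁ h₁ z₂ h₂ h
  apply e.injOn_puncturedEnd h₁ h₂
  rw [← hJ z₁ h₁, ← hJ z₂ h₂, h]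

/-- The left inverse of a lift of the end: `puncturedEndInv ∘ F`. [folklore] -/
theorem puncturedEndInv_apply_lift (hJ : ∀ z, z ≠ 0 → F (J z) = e.puncturedEnd z) {z : E3}
    (hz : z ≠ 0) : e.puncturedEndInv (F (J z)) = z := by
  rw [hJ z hz, e.puncturedEndInv_puncturedEnd hz]

/-- **A lift of the end maps open sets to open sets**: `F` being a local homeomorphism, a
continuous lift `J` of the open map `puncturedEnd` is locally `(F|_V)⁻¹ ∘ puncturedEnd`.
[folklore] -/
theorem isOpen_image_lift (hF : IsLocalHomeomorph F) (hJc : ContinuousOn J {0}ᶜ)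
    (hJ : ∀ z, z ≠ 0 → F (J z) = e.puncturedEnd z) {s : Set E3} (hs : IsOpen s) (hs0 : s ⊆ {0}ᶜ) :
    IsOpen (J '' s) := by
  rw [isOpen_iff_forall_mem_open]
  rintro _ ⟨z, hz, rfl⟩
  obtain ⟨h, hzh, hFh⟩ := hF (J z)
  -- the part of `s` lifted into the source of the local homeomorphism `h`
  set N : Set E3 := s ∩ J ⁻¹' h.source with hN_def
  have hNo : IsOpen N := (hJc.mono hs0).isOpen_inter_preimage hs h.open_source
  have hN0 : N ⊆ {0}ᶜ := inter_subset_left.trans hs0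
  have hJN : J '' N = h.symm '' (e.puncturedEnd '' N) := by
    rw [image_image]
    refine image_congr fun z' hz' ↦ ?_
    rw [← hJ z' (hN0 hz'), hFh, h.left_inv hz'.2]
  have hsub : e.puncturedEnd '' N ⊆ h.symm.source := by
    rintro _ ⟨z', hz', rfl⟩
    rw [← hJ z' (hN0 hz'), hFh, h.symm_source]
    exact h.map_source hz'.2
  refine ⟨J '' N, image_mono inter_subset_left, ?_, ⟨z, ⟨hz, hzh⟩, rfl⟩⟩
  rw [hJN]
  exact h.symm.isOpen_image_of_subset_source (e.isOpen_image_puncturedEnd hNo hN0) hsub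

/-- **The image of a closed far region under a lift is closed**: it is the set of points `w` over
the closed far region `Φ({R + 1 ≤ ‖y‖})` fixed by `J ∘ puncturedEndInv ∘ F`. [folklore] -/
theorem isClosed_image_lift (hFc : Continuous F) (hJc : ContinuousOn J {0}ᶜ)
    (hJ : ∀ z, z ≠ 0 → F (J z) = e.puncturedEnd z) :
    IsClosed (J '' {z | 1 ≤ ‖z‖}) := by
  set C : Set E3 := {z | 1 ≤ ‖z‖} with hC_def
  have hC0 : C ⊆ {0}ᶜ := fun z hz (h0 : z = 0) ↦ by
    rw [h0] at hz; simp only [hC_def, mem_setOf_eq, norm_zero] at hz; linarith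
  set K : Set X := e.puncturedEnd '' C with hK_def
  have hK : IsClosed K := e.isClosed_image_puncturedEnd one_pos
  have hKU : K ⊆ (e.U : Set X) := by
    rintro _ ⟨z, -, rfl⟩; exact e.puncturedEnd_mem z
  set S : Set E3 := F ⁻¹' K with hS_def
  have hS : IsClosed S := hK.preimage hFc
  -- the map `m = J ∘ puncturedEndInv ∘ F` is continuous on `S`
  set m : E3 → E3 := fun w ↦ J (e.puncturedEndInv (F w)) with hm_def
  have hm : ContinuousOn m S := by
    have h1 : ContinuousOn (fun w ↦ e.puncturedEndInv (F w)) S :=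
      e.continuousOn_puncturedEndInv.comp hFc.continuousOn fun w hw ↦ hKU hw
    refine hJc.comp h1 fun w hw ↦ ?_
    obtain ⟨z, hz, hzw⟩ := hw
    show e.puncturedEndInv (F w) ∈ ({0}ᶜ : Set E3)
    rw [← hzw, e.puncturedEndInv_puncturedEnd (hC0 hz)]
    exact hC0 hz
  have heq : J '' C = S ∩ (fun w ↦ (m w, w)) ⁻¹' (diagonal E3) := by
    ext w
    simp only [mem_inter_iff, mem_preimage, mem_diagonal_iff]
    constructor
    · rintro ⟨z, hz, rfl⟩
      refine ⟨⟨z, hz, (hJ z (hC0 hz)).symm⟩, ?_⟩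
      simp only [hm_def, e.puncturedEndInv_apply_lift hJ (hC0 hz)]
    · rintro ⟨⟨z, hz, hzw⟩, hmw⟩
      refine ⟨z, hz, ?_⟩
      rw [← hmw, hm_def]
      simp only [← hzw, e.puncturedEndInv_puncturedEnd (hC0 hz)]
  rw [heq]
  exact (hm.prodMk continuousOn_id).preimage_isClosed_of_isClosed hS isClosed_diagonal

/-- The exterior `{1 ≤ ‖z‖}` of the unit ball of `ℝ³` is not bounded. [folklore] -/
theorem not_isBounded_exterior : ¬ Bornology.IsBounded {z : E3 | 1 ≤ ‖z‖} := by
  intro hb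
  obtain ⟨r, hr⟩ := (isBounded_iff_subset_closedBall 0).1 hb
  have hmem : EuclideanSpace.single (0 : Fin 3) (|r| + 1) ∈ {z : E3 | 1 ≤ ‖z‖} := by
    simp only [mem_setOf_eq, PiLp.norm_single, Real.norm_eq_abs]
    rw [abs_of_pos (by positivity)]
    linarith [abs_nonneg r]
  have h := hr hmem
  rw [mem_closedBall, dist_zero_right, PiLp.norm_single, Real.norm_eq_abs,
    abs_of_pos (by positivity)] at h
  linarith [le_abs_self r]

/-- **The image of the closed far region under a lift is unbounded**: otherwise it would be
compact, and so would be its homeomorphic preimage `{1 ≤ ‖z‖}`. [folklore] -/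
theorem not_isBounded_image_lift (hFc : Continuous F) (hJc : ContinuousOn J {0}ᶜ)
    (hJ : ∀ z, z ≠ 0 → F (J z) = e.puncturedEnd z) :
    ¬ Bornology.IsBounded (J '' {z | 1 ≤ ‖z‖}) := by
  intro hb
  set C : Set E3 := {z | 1 ≤ ‖z‖} with hC_def
  have hC0 : C ⊆ {0}ᶜ := fun z hz (h0 : z = 0) ↦ by
    rw [h0] at hz; simp only [hC_def, mem_setOf_eq, norm_zero] at hz; linarith
  have hcpt : IsCompact (J '' C) := isCompact_of_isClosed_isBounded (e.isClosed_image_lift hFc hJc hJ) hb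
  -- `C` is the continuous image of `J '' C` under `puncturedEndInv ∘ F`
  have hsub : J '' C ⊆ F ⁻¹' (e.U : Set X) := by
    rintro _ ⟨z, hz, rfl⟩
    show F (J z) ∈ (e.U : Set X)
    rw [hJ z (hC0 hz)]; exact e.puncturedEnd_mem z
  have hcont : ContinuousOn (fun w ↦ e.puncturedEndInv (F w)) (J '' C) :=
    e.continuousOn_puncturedEndInv.comp hFc.continuousOn hsub
  have himg : (fun w ↦ e.puncturedEndInv (F w)) '' (J '' C) = C := by
    rw [image_image]
    refine (image_congr fun z hz ↦ e.puncturedEndInv_apply_lift hJ (hC0 hz)).trans ?_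
    rw [image_id']
  have hC : IsCompact C := himg ▸ hcpt.image_of_continuousOn hcont
  exact not_isBounded_exterior hC.isBounded

/-- **A lift of the end contains a neighbourhood of infinity**: for a local homeomorphism
`F : ℝ³ → X` and a continuous lift `J` of the end on `ℝ³ ∖ {0}`, the open set `J({1 < ‖z‖})`
contains the exterior of some ball: its frontier lies in the compact set `J({‖z‖ = 1})`, it is
unbounded, and the exterior of a large ball is connected. [folklore] -/
theorem exists_compl_closedBall_subset_image_lift (hF : IsLocalHomeomorph F)
    (hJc : ContinuousOn J {0}ᶜ) (hJ : ∀ z, z ≠ 0 → F (J z) = e.puncturedEnd z) :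
    ∃ r : ℝ, (closedBall (0 : E3) r)ᶜ ⊆ J '' {z | 1 < ‖z‖} := by
  have hFc : Continuous F := hF.continuous
  set O : Set E3 := {z | 1 < ‖z‖} with hO_def
  set C : Set E3 := {z | 1 ≤ ‖z‖} with hC_def
  set S₁ : Set E3 := sphere 0 1 with hS₁_def
  have hO0 : O ⊆ {0}ᶜ := fun z hz (h0 : z = 0) ↦ by
    rw [h0] at hz; simp only [hO_def, mem_setOf_eq, norm_zero] at hz; linarith
  have hS0 : S₁ ⊆ {0}ᶜ := fun z hz (h0 : z = 0) ↦ by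
    rw [h0] at hz; simp [hS₁_def] at hz
  have hOC : O ⊆ C := fun z hz ↦ le_of_lt (show 1 < ‖z‖ from hz)
  have hCOS : ∀ z ∈ C, z ∉ S₁ → z ∈ O := fun z hz hzS ↦ by
    simp only [hS₁_def, mem_sphere_iff_norm, sub_zero] at hzS
    exact lt_of_le_of_ne hz (Ne.symm hzS)
  -- the image of the unit sphere is compact, hence inside a ball
  have hSig : IsCompact (J '' S₁) := (isCompact_sphere 0 1).image_of_continuousOn (hJc.mono hS0)
  obtain ⟨r₀, hr₀⟩ := (isBounded_iff_subset_closedBall 0).1 hSig.isBounded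
  set r : ℝ := max r₀ 1 with hr_def
  have hSigr : J '' S₁ ⊆ closedBall 0 r := hr₀.trans (closedBall_subset_closedBall (le_max_left _ _))
  refine ⟨r, ?_⟩
  set D : Set E3 := (closedBall (0 : E3) r)ᶜ with hD_def
  have hD : IsPreconnected D :=
    (isPathConnected_compl_closedBall (le_trans zero_le_one (le_max_right r₀ 1))).isConnected.isPreconnected
  -- the two open sets
  have hu : IsOpen (J '' O) := e.isOpen_image_lift hF hJc hJ (isOpen_lt continuous_const continuous_norm) hO0
  have hv : IsOpen (J '' C)ᶜ := (e.isClosed_image_lift hFc hJc hJ).isOpen_compl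
  have hDuv : D ⊆ J '' O ∪ (J '' C)ᶜ := by
    intro d hd
    by_cases hdC : d ∈ J '' C
    · obtain ⟨z, hz, rfl⟩ := hdC
      refine Or.inl ⟨z, hCOS z hz fun hzS ↦ hd (hSigr ⟨z, hzS, rfl⟩), rfl⟩
    · exact Or.inr hdC
  -- `D` meets `J '' O`, the image of `C` being unbounded
  have hDu : (D ∩ J '' O).Nonempty := by
    have hnb := e.not_isBounded_image_lift hFc hJc hJ
    rw [isBounded_iff_subset_closedBall 0] at hnb
    push Not at hnb
    obtain ⟨w, hwC, hwr⟩ := not_subset.1 (hnb r)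
    obtain ⟨z, hz, rfl⟩ := hwC
    exact ⟨J z, hwr, z, hCOS z hz fun hzS ↦ hwr (hSigr ⟨z, hzS, rfl⟩), rfl⟩
  -- hence `D` does not meet the complement of `J '' C`
  have hDv : ¬ (D ∩ (J '' C)ᶜ).Nonempty := by
    intro hDv
    obtain ⟨w, -, hwu, hwv⟩ := hD _ _ hu hv hDuv hDu hDv
    exact hwv (image_mono hOC hwu)
  intro d hd
  rcases hDuv hd with h | h
  · exact h
  · exact absurd ⟨d, hd, h⟩ hDv

/-! ### The main theorems -/

/-- A point of `ℝ³` off the line spanned by `single 0 1`. [folklore] -/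
theorem single_one_not_mem_span :
    (EuclideanSpace.single (1 : Fin 3) (1 : ℝ) : E3) ∉
      (ℝ ∙ (EuclideanSpace.single (0 : Fin 3) (1 : ℝ) : E3) : Submodule ℝ E3) := by
  rw [Submodule.mem_span_singleton]
  rintro ⟨a, ha⟩
  have h := congrArg (fun z : E3 ↦ z 1) ha
  simp at h

/-- **Covering maps from `ℝ³` onto a space with an asymptotically flat end are injective.** Let
`X` (charted on `ℝ³`) carry an asymptotically flat end `e` — an open set diffeomorphic to the
exterior of a ball, closed at infinity — and let `F : ℝ³ → X` be a surjective covering map. Then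
`F` is injective. (With the Cartan–Hadamard theorem, Lee 2018, Thm. 12.8, this is the flat case of
Greene–Wu 1993, Thm. A; the proof lifts the simply connected end through `F` and through a deck
transformation of `F`, obtaining two disjoint neighbourhoods of infinity in `ℝ³`.)
[cite: GreeneWu1993, Thm. A (p. 328)] -/
theorem injective_of_isCoveringMap (e : AFEnd X) (hF : IsCoveringMap F) (hsurj : Surjective F) :
    Injective F := by
  by_contra hinj
  obtain ⟨v₁, v₂, heq, hne⟩ := not_injective_iff.1 hinj
  -- a fixed-point free deck transformation
  obtain ⟨τ, hτc, hτF, -, hτfix⟩ := exists_deck_of_isCoveringMap hF hne heq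
  -- lift the end through `F`
  set v : E3 := EuclideanSpace.single (0 : Fin 3) (1 : ℝ) with hv_def
  set z₀ : E3 := EuclideanSpace.single (1 : Fin 3) (1 : ℝ) with hz₀_def
  have hv : v ≠ 0 := by
    rw [hv_def, Ne, PiLp.single_eq_zero_iff]; exact one_ne_zero
  obtain ⟨w₀, hw₀⟩ := hsurj (e.puncturedEnd z₀)
  have h3 : 3 ≤ Module.finrank ℝ E3 := by rw [finrank_euclideanSpace_fin]
  obtain ⟨J, hJc, hJ, -⟩ := exists_lift_on_compl_zero h3 hF e.continuousOn_puncturedEnd hv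
    single_one_not_mem_span hw₀
  -- the second lift `τ ∘ J`
  have hJ'c : ContinuousOn (τ ∘ J) {0}ᶜ := hτc.comp_continuousOn hJc
  have hJ' : ∀ z, z ≠ 0 → F ((τ ∘ J) z) = e.puncturedEnd z := fun z hz ↦ by
    rw [comp_apply, hτF, hJ z hz]
  -- both contain a neighbourhood of infinity
  obtain ⟨r, hr⟩ := e.exists_compl_closedBall_subset_image_lift hF.isLocalHomeomorph hJc hJ
  obtain ⟨r', hr'⟩ := e.exists_compl_closedBall_subset_image_lift hF.isLocalHomeomorph hJ'c hJ'
  -- a point far out lies in both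
  set w : E3 := EuclideanSpace.single (0 : Fin 3) (|max r r'| + 1) with hw_def
  have hw : ‖w‖ = |max r r'| + 1 := by
    rw [hw_def, PiLp.norm_single, Real.norm_eq_abs, abs_of_pos (by positivity)]
  have hwr : w ∈ (closedBall (0 : E3) r)ᶜ := by
    rw [mem_compl_iff, mem_closedBall, dist_zero_right, hw, not_le]
    linarith [le_abs_self (max r r'), le_max_left r r']
  have hwr' : w ∈ (closedBall (0 : E3) r')ᶜ := by
    rw [mem_compl_iff, mem_closedBall, dist_zero_right, hw, not_le]
    linarith [le_abs_self (max r r'), le_max_right r r']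
  obtain ⟨z₁, hz₁, hz₁w⟩ := hr hwr
  obtain ⟨z₂, hz₂, hz₂w⟩ := hr' hwr'
  have hz₁0 : z₁ ≠ 0 := by
    rintro rfl; simp only [mem_setOf_eq, norm_zero] at hz₁; linarith
  have hz₂0 : z₂ ≠ 0 := by
    rintro rfl; simp only [mem_setOf_eq, norm_zero] at hz₂; linarith
  -- they come from the same point of the end, so `τ` fixes `J z₁`
  have h12 : z₁ = z₂ := by
    apply e.injOn_puncturedEnd hz₁0 hz₂0
    rw [← hJ z₁ hz₁0, ← hJ' z₂ hz₂0, hz₁w, hz₂w]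
  subst h12
  exact hτfix (J z₁) (hz₂w.trans hz₁w.symm)

/-- **The image of a covering map is closed**: a point outside the image has an evenly covered
neighbourhood with empty fibre, hence disjoint from the image. [folklore] -/
theorem _root_.IsCoveringMap.isClosed_range {W Y : Type*} [TopologicalSpace W] [TopologicalSpace Y]
    {p : W → Y} (hp : IsCoveringMap p) : IsClosed (range p) := by
  rw [← isOpen_compl_iff, isOpen_iff_forall_mem_open]
  intro y hy
  obtain ⟨-, U, hyU, hU, -, H, -⟩ := hp y
  refine ⟨U, fun y' hy' hy'r ↦ ?_, hU, hyU⟩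
  obtain ⟨w, hw⟩ := hy'r
  have hwU : w ∈ p ⁻¹' U := by rw [mem_preimage, hw]; exact hy'
  obtain ⟨w', hw'⟩ := (H ⟨w, hwU⟩).2
  exact hy ⟨w', hw'⟩

/-- A covering map with nonempty total space onto a connected space is surjective. [folklore] -/
theorem _root_.IsCoveringMap.surjective_of_connectedSpace {W Y : Type*} [TopologicalSpace W]
    [TopologicalSpace Y] [Nonempty W] [ConnectedSpace Y] {p : W → Y} (hp : IsCoveringMap p) :
    Surjective p := by
  have hclopen : IsClopen (range p) := ⟨hp.isClosed_range, hp.isLocalHomeomorph.isOpenMap.isOpen_range⟩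
  rw [← range_eq_univ]
  exact hclopen.eq_univ (range_nonempty p)

/-- **Covering maps from `ℝ³` to a connected space with an asymptotically flat end are
homeomorphisms** (surjective by connectedness, injective by `injective_of_isCoveringMap`, open as
local homeomorphisms). In particular such a space is simply connected. With Lee 2018, Thm. 12.8
(Cartan–Hadamard) this gives the flat case of Greene–Wu 1993, Thm. A.
[cite: GreeneWu1993, Thm. A (p. 328)] -/
theorem isHomeomorph_of_isCoveringMap (e : AFEnd X) [ConnectedSpace X] (hF : IsCoveringMap F) :
    IsHomeomorph F :=
  have hsurj : Surjective F := hF.surjective_of_connectedSpace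
  ⟨hF.continuous, hF.isLocalHomeomorph.isOpenMap, ⟨e.injective_of_isCoveringMap hF hsurj, hsurj⟩⟩

end AFEnd


end Literature.Geometry.Lorentzian

end
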